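/-
Copyright (c) 2026 the pub-hodgecm-mathlib formalisation cell (harness21).  Prover seat hodgecm-mathlib-A-p12 (g25): road «S3-ram» (LEAD F0P3a-plan (g13); (Cnt2′) chair
F0P3a-p07 (g15) RULING (13) organ (4b), RULING (16)(a) regime B; (α) keeper F0P3a-p06 (g16)); organ (K4c): the region sums keyed on kind counts; 2026-09-02.
-/
import Literature.NumberTheory.Rogawski1990.DepthZeroKappaTransferTypeTwoRamifiedHyperbolicVertexCensus   -- ★ (K4b) 3/3 (this seat): the six per-kind heads; brings (K4b) 1–2, (K4a)
import Literature.NumberTheory.Rogawski1990.DepthZeroKappaTransferTypeTwoRamifiedRegionCensusKinds      -- ★ p849034 (F0P3-p03 (g16)): (4a) `regionCensus_block_of_kindCounts`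
import HarnessLib

/-!
# The ramified `κ`-orbital integral, TYPE (2): THE REGION SUMS `ΣE, ΣP, ΣM` OF THE HYPERBOLIC BLOCK LITERAL, REGIME B, KEYED ON THE THREE KIND COUNTS
# (organ (4b) ∘ (4a); part (K4c); Kottwitz 1986 §3; Rogawski 1990 §4.9; Labesse–Langlands 1979 §2)

Topic `NumberTheory/Rogawski1990`; namespace `Literature.NumberTheory.Rogawski1990.TypeOneRamifiedJunction`.  THEOREMS ONLY (no definition, no instance, no notation, no
named fact, no `sorry`); kernel lane `--supports stmt-HodgeConjecture-24833`; datum-free.  Cell `pub/hodgecm-mathlib` (D-0151), crux H413; road «S3-ram» (count-neutral);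
(Cnt2′) ROUTE B, chair RULING (13) organs (4a) (F0P3-p03 (g16), ★ `regionCensus_block_of_kindCounts`) and (4b) (A-p12 (g25), ★ (K4b) `hyperbolicVertexCensus_*`), composed:
the SHARED MIDDLE LAYER of the four regime-B hyperbolic cells `stub_Zhyp_{zero,pm}_{even,odd}_B` (pens F0P3a-p08 (g21) ∕ F0P3a-p04 (g21); F0P3a-p04 05:26:47Z).  For the
hyperbolic literal `↑γ = ι(B₀, 1)` in REGIME B (`|(B₀ − 1)ᵢⱼ| ≤ |ϖ|^{d₀}`, `|½tr B₀ − 1| = |ϖ|^{d₀}`, `|tr² − 4det| < |ϖ|^{2d₀}`, `d₀ ≥ 3` odd), the raw head's region Finset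
`sR` (`hsR` VERBATIM) and the three KIND COUNTS in F0P3a-p08 (g21)'s ★ p849463 (K5-B-J) J1 set currency (VERBATIM left-hand sides of `ncard_rootRegion_{inner,
shell_not_class, shell_class}_eq_ncard_two`): `n₀ = #{v ∈ R ∣ Pin v}` (INNER), `n₁ = #{v ∈ R ∣ ¬Pin v ∧ ¬Qbig v}` (SMALL), `n₂ = #{v ∈ R ∣ ¬Pin v ∧ Qbig v}` (BIG):
* **`regionSums_hyperbolic_of_kindCounts_of_lock`** (`Λ(c₁)`): `#sR = n₀ + n₁ + n₂`, `ΣE = n₂·2q`, `ΣP = n₀·q(q−1) + n₁·q((q−1)/2) + n₂·q((q−3)/2)`, `ΣM = n₁·q((q+1)/2) + n₂·q((q−1)/2)`;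
* **`regionSums_hyperbolic_of_kindCounts_of_not_lock`** (`¬Λ(c₁)`): `ΣE = n₂·2q`, `ΣP = n₁·q((q+1)/2) + n₂·q((q−1)/2)`, `ΣM = n₀·q(q−1) + n₁·q((q−1)/2) + n₂·q((q−3)/2)`
— the `(hNE, hNP, hNM)` of ★ `BlockLawHyp.hyperbolicTotal_{zero,pm}_ram_of_region_census_odd` (p849287 ∕ p849335) once `n₀ n₁ n₂` are F0P3a-p08's (K5-B-J) FILE 2 numbers (with
`n₁ = n₂`, B-p14 (g40) MEMO v2: `ΣE = q·n_shell`, `Σ(P+M) = (q−1)q·#R`, `ΣP − ΣM = ∓(…)`).  E∕P∕M sets = the raw head's `hPE ∕ hPP ∕ hPM` summands VERBATIM.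
HONEST LABEL: HC_CM is proved only modulo the 2 remaining named inputs (hLiu418 24832, h413 24833) until rung 0 closes; nothing printed is asserted here (lattice
bookkeeping over ★ results); «S3-ram» is Literature seeding, count-neutral.

## References
* [Kottwitz1986] R. E. Kottwitz, *Base change for unit elements of Hecke algebras*, Compositio Math. 60 (1986), §3.
* [Rogawski1990] J. D. Rogawski, *Automorphic Representations of Unitary Groups in Three Variables*, Ann. of Math. Stud. 123 (1990), §4.9 pp. 54–56, Prop. 4.9.1 (b).
* [LabesseLanglands1979] J.-P. Labesse, R. P. Langlands, *L-indistinguishability for SL(2)*, Canad. J. Math. 31 (1979), §2 Lemma 2.1.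
* [BruhatTits1972] F. Bruhat, J. Tits, *Groupes réductifs sur un corps local I*, Publ. Math. IHÉS 41 (1972), §10.
-/

set_option autoImplicit false

noncomputable section

open scoped Valued WithZero Matrix MatrixGroups
open Polynomial Classical SimpleGraph
open Literature.NumberTheory.Automorphic Literature.NumberTheory.Automorphic.HermitianLattice Literature.NumberTheory.Automorphic.UnitaryLatticeTree
open Literature.NumberTheory.Automorphic.UnitaryGroup

namespace Literature.NumberTheory.Rogawski1990.TypeOneRamifiedJunction

variable {K : Type*} [Field K] [Valued K ℤᵐ⁰] {σ : K →+* K} {ϖ : K}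

/-- Kind counts in set currency give the `Finset.filter` counts of ★ (4a). [cite: Kottwitz1986, §3] -/
theorem card_filter_eq_of_ncard_eq {γ : unitaryGroupOfForm σ ((StdForm.antidiagonal 3).over K)} {d₀ : ℕ}
    (sR : Finset {M : Submodule 𝒪[K] (Fin 3 → K) // IsVertex σ ϖ ((StdForm.antidiagonal 3).over K) M})
    (hsR : ∀ v, v ∈ sR ↔ v ∈ {v : {M : Submodule 𝒪[K] (Fin 3 → K) // IsVertex σ ϖ ((StdForm.antidiagonal 3).over K) M} | latticeGraphIso σ ϖ ((StdForm.antidiagonal 3).over K) γ v = v ∧ IsSelfDualLattice σ ϖ ((StdForm.antidiagonal 3).over K) v.1 ∧ v.1.map ((Matrix.toLin' (((γ : GL (Fin 3) K) : Matrix (Fin 3) (Fin 3) K) - 1)).restrictScalars 𝒪[K]) ≤ scaleLattice (ϖ ^ d₀) v.1})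
    (Pr : {M : Submodule 𝒪[K] (Fin 3 → K) // IsVertex σ ϖ ((StdForm.antidiagonal 3).over K) M} → Prop) [DecidablePred Pr] {n : ℕ}
    (h : {v : {M : Submodule 𝒪[K] (Fin 3 → K) // IsVertex σ ϖ ((StdForm.antidiagonal 3).over K) M} | v ∈ {v : {M : Submodule 𝒪[K] (Fin 3 → K) // IsVertex σ ϖ ((StdForm.antidiagonal 3).over K) M} | latticeGraphIso σ ϖ ((StdForm.antidiagonal 3).over K) γ v = v ∧ IsSelfDualLattice σ ϖ ((StdForm.antidiagonal 3).over K) v.1 ∧ v.1.map ((Matrix.toLin' (((γ : GL (Fin 3) K) : Matrix (Fin 3) (Fin 3) K) - 1)).restrictScalars 𝒪[K]) ≤ scaleLattice (ϖ ^ d₀) v.1} ∧ Pr v}.ncard = n) :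
    (sR.filter fun v => Pr v).card = n := by
  rw [← h, ← Set.ncard_coe_finset, Finset.coe_filter]
  congr 1
  ext x
  simp only [Set.mem_setOf_eq, hsR]

set_option maxHeartbeats 3200000 in
-- budget only: statement-heavy lattice tokens (three grandchild sets, region and kind sets).
/-- **(K4c) REGION SUMS, LOCK `Λ(c₁)`**: `#sR = n₀ + n₁ + n₂`, `ΣE = n₂·2q`, `ΣP = n₀·q(q−1) + n₁·q((q−1)/2) + n₂·q((q−3)/2)`, `ΣM = n₁·q((q+1)/2) + n₂·q((q−1)/2)` (★ (4a) ∘ ★ (K4b)).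
[cite: Kottwitz1986, §3] [cite: Rogawski1990, §4.9 Prop. 4.9.1 (b) p. 55] [cite: LabesseLanglands1979, §2 Lemma 2.1] -/
theorem regionSums_hyperbolic_of_kindCounts_of_lock (hσ : ∀ x, σ (σ x) = x) (hvσ : ∀ a, Valued.v (σ a) = Valued.v a) (hσϖ : σ ϖ = -ϖ)
    (hϖ : Valued.v ϖ = WithZero.exp (-1 : ℤ)) (hres : ∀ x : K, Valued.v x ≤ 1 → Valued.v (σ x - x) < 1) (h2 : Valued.v (2 : K) = 1)
    (hnorm : ∀ u : K, σ u = u → Valued.v (u - 1) < 1 → ∃ z : K, z * σ z = u ∧ Valued.v (z - 1) ≤ Valued.v (u - 1))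
    [Fintype 𝓀[K]] [DecidableEq 𝓀[K]] [ValuativeRel K] [(Valued.v : Valuation K ℤᵐ⁰).Compatible] [IsPrincipalIdealRing 𝒪[K]]
    (hT : (latticeGraph σ ϖ ((StdForm.antidiagonal 3).over K)).IsTree)
    {γ : unitaryGroupOfForm σ ((StdForm.antidiagonal 3).over K)} (B₀ : GL (Fin 2) K) (hγ : (γ : GL (Fin 3) K) = endoGL (B₀, (1 : GL (Fin 1) K)))
    {d₀ : ℕ} (hd3 : 3 ≤ d₀) (hodd : Odd d₀)
    (hnil3 : ∀ (w : {M : Submodule 𝒪[K] (Fin 3 → K) // IsVertex σ ϖ ((StdForm.antidiagonal 3).over K) M}) (e : ℕ), e + 1 ≤ d₀ →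
      w.1.map ((Matrix.toLin' (((γ : GL (Fin 3) K) : Matrix (Fin 3) (Fin 3) K) - 1)).restrictScalars 𝒪[K]) ≤ scaleLattice (ϖ ^ e) w.1 →
      w.1.map ((Matrix.toLin' ((((γ : GL (Fin 3) K) : Matrix (Fin 3) (Fin 3) K) - 1) ^ 3)).restrictScalars 𝒪[K]) ≤ scaleLattice (ϖ ^ (3 * e + 1)) w.1)
    (hBm : ∀ i j, Valued.v (((B₀ : Matrix (Fin 2) (Fin 2) K) - 1) i j) ≤ Valued.v ϖ ^ d₀)
    (hdisc : Valued.v ((B₀ : Matrix (Fin 2) (Fin 2) K).trace ^ 2 - 4 * (B₀ : Matrix (Fin 2) (Fin 2) K).det) < Valued.v ϖ ^ (2 * d₀))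
    (hcB : Valued.v ((B₀ : Matrix (Fin 2) (Fin 2) K).trace / 2 - 1) = Valued.v ϖ ^ d₀)
    (c₁ ε : K) (hc₁ : Valued.v c₁ = 1) (hεv : Valued.v ε = 1) (hε : ∀ z : K, Valued.v z ≤ 1 → Valued.v (z ^ 2 - ε) = 1)
    (sR : Finset {M : Submodule 𝒪[K] (Fin 3 → K) // IsVertex σ ϖ ((StdForm.antidiagonal 3).over K) M})
    (hsR : ∀ v, v ∈ sR ↔ v ∈ {v : {M : Submodule 𝒪[K] (Fin 3 → K) // IsVertex σ ϖ ((StdForm.antidiagonal 3).over K) M} | latticeGraphIso σ ϖ ((StdForm.antidiagonal 3).over K) γ v = v ∧ IsSelfDualLattice σ ϖ ((StdForm.antidiagonal 3).over K) v.1 ∧ v.1.map ((Matrix.toLin' (((γ : GL (Fin 3) K) : Matrix (Fin 3) (Fin 3) K) - 1)).restrictScalars 𝒪[K]) ≤ scaleLattice (ϖ ^ d₀) v.1})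
    (n₀ n₁ n₂ : ℕ) (hn₀ : {v : {M : Submodule 𝒪[K] (Fin 3 → K) // IsVertex σ ϖ ((StdForm.antidiagonal 3).over K) M} | v ∈ {v : {M : Submodule 𝒪[K] (Fin 3 → K) // IsVertex σ ϖ ((StdForm.antidiagonal 3).over K) M} | latticeGraphIso σ ϖ ((StdForm.antidiagonal 3).over K) γ v = v ∧ IsSelfDualLattice σ ϖ ((StdForm.antidiagonal 3).over K) v.1 ∧ v.1.map ((Matrix.toLin' (((γ : GL (Fin 3) K) : Matrix (Fin 3) (Fin 3) K) - 1)).restrictScalars 𝒪[K]) ≤ scaleLattice (ϖ ^ d₀) v.1} ∧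
        ∀ y ∈ v.1, y 1 = 0 → ((((γ : GL (Fin 3) K) : Matrix (Fin 3) (Fin 3) K) - ((B₀ : Matrix (Fin 2) (Fin 2) K).trace / 2) • (1 : Matrix (Fin 3) (Fin 3) K)) *ᵥ y) ∈ scaleLattice (ϖ ^ (d₀ + 1)) v.1}.ncard = n₀)
    (hn₁ : {v : {M : Submodule 𝒪[K] (Fin 3 → K) // IsVertex σ ϖ ((StdForm.antidiagonal 3).over K) M} | v ∈ {v : {M : Submodule 𝒪[K] (Fin 3 → K) // IsVertex σ ϖ ((StdForm.antidiagonal 3).over K) M} | latticeGraphIso σ ϖ ((StdForm.antidiagonal 3).over K) γ v = v ∧ IsSelfDualLattice σ ϖ ((StdForm.antidiagonal 3).over K) v.1 ∧ v.1.map ((Matrix.toLin' (((γ : GL (Fin 3) K) : Matrix (Fin 3) (Fin 3) K) - 1)).restrictScalars 𝒪[K]) ≤ scaleLattice (ϖ ^ d₀) v.1} ∧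
        ¬ (∀ y ∈ v.1, y 1 = 0 → ((((γ : GL (Fin 3) K) : Matrix (Fin 3) (Fin 3) K) - ((B₀ : Matrix (Fin 2) (Fin 2) K).trace / 2) • (1 : Matrix (Fin 3) (Fin 3) K)) *ᵥ y) ∈ scaleLattice (ϖ ^ (d₀ + 1)) v.1) ∧
        ¬ (∃ y ∈ v.1, y 1 = 0 ∧ ∃ a : K, Valued.v a = 1 ∧ Valued.v ((ϖ ^ d₀)⁻¹ * pairing σ ((StdForm.antidiagonal 3).over K) y ((((γ : GL (Fin 3) K) : Matrix (Fin 3) (Fin 3) K) - ((B₀ : Matrix (Fin 2) (Fin 2) K).trace / 2) • (1 : Matrix (Fin 3) (Fin 3) K)) *ᵥ y) - ((ϖ ^ d₀)⁻¹ * ((B₀ : Matrix (Fin 2) (Fin 2) K).trace / 2 - 1)) * a ^ 2) < 1)}.ncard = n₁)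
    (hn₂ : {v : {M : Submodule 𝒪[K] (Fin 3 → K) // IsVertex σ ϖ ((StdForm.antidiagonal 3).over K) M} | v ∈ {v : {M : Submodule 𝒪[K] (Fin 3 → K) // IsVertex σ ϖ ((StdForm.antidiagonal 3).over K) M} | latticeGraphIso σ ϖ ((StdForm.antidiagonal 3).over K) γ v = v ∧ IsSelfDualLattice σ ϖ ((StdForm.antidiagonal 3).over K) v.1 ∧ v.1.map ((Matrix.toLin' (((γ : GL (Fin 3) K) : Matrix (Fin 3) (Fin 3) K) - 1)).restrictScalars 𝒪[K]) ≤ scaleLattice (ϖ ^ d₀) v.1} ∧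
        ¬ (∀ y ∈ v.1, y 1 = 0 → ((((γ : GL (Fin 3) K) : Matrix (Fin 3) (Fin 3) K) - ((B₀ : Matrix (Fin 2) (Fin 2) K).trace / 2) • (1 : Matrix (Fin 3) (Fin 3) K)) *ᵥ y) ∈ scaleLattice (ϖ ^ (d₀ + 1)) v.1) ∧
        ∃ y ∈ v.1, y 1 = 0 ∧ ∃ a : K, Valued.v a = 1 ∧ Valued.v ((ϖ ^ d₀)⁻¹ * pairing σ ((StdForm.antidiagonal 3).over K) y ((((γ : GL (Fin 3) K) : Matrix (Fin 3) (Fin 3) K) - ((B₀ : Matrix (Fin 2) (Fin 2) K).trace / 2) • (1 : Matrix (Fin 3) (Fin 3) K)) *ᵥ y) - ((ϖ ^ d₀)⁻¹ * ((B₀ : Matrix (Fin 2) (Fin 2) K).trace / 2 - 1)) * a ^ 2) < 1}.ncard = n₂)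
    (hΛ : ∃ a : K, Valued.v a = 1 ∧ Valued.v (((ϖ ^ d₀)⁻¹ * ((B₀ : Matrix (Fin 2) (Fin 2) K).trace / 2 - 1)) - c₁ * a ^ 2) < 1) :
    sR.card = n₀ + n₁ + n₂ ∧
    ∑ v ∈ sR, ({w | w ∈ {w | ∃ c, ((latticeGraph σ ϖ ((StdForm.antidiagonal 3).over K)).Adj v c ∧ (latticeGraph σ ϖ ((StdForm.antidiagonal 3).over K)).dist ⟨stdLattice K 3, 0, isSelfDualLattice_stdLattice_three_of_v hϖ⟩ c = (latticeGraph σ ϖ ((StdForm.antidiagonal 3).over K)).dist ⟨stdLattice K 3, 0, isSelfDualLattice_stdLattice_three_of_v hϖ⟩ v + 1 ∧ latticeGraphIso σ ϖ ((StdForm.antidiagonal 3).over K) γ c = c) ∧ ((latticeGraph σ ϖ ((StdForm.antidiagonal 3).over K)).Adj c w ∧ (latticeGraph σ ϖ ((StdForm.antidiagonal 3).over K)).dist ⟨stdLattice K 3, 0, isSelfDualLattice_stdLattice_three_of_v hϖ⟩ w = (latticeGraph σ ϖ ((StdForm.antidiagonal 3).over K)).dist ⟨stdLattice K 3, 0,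 isSelfDualLattice_stdLattice_three_of_v hϖ⟩ c + 1 ∧ latticeGraphIso σ ϖ ((StdForm.antidiagonal 3).over K) γ w = w)} ∧ (¬ w.1.map ((Matrix.toLin' (((γ : GL (Fin 3) K) : Matrix (Fin 3) (Fin 3) K) - 1)).restrictScalars 𝒪[K]) ≤ scaleLattice (ϖ ^ d₀) w.1 ∧ (w.1.map ((Matrix.toLin' (((γ : GL (Fin 3) K) : Matrix (Fin 3) (Fin 3) K) - 1)).restrictScalars 𝒪[K]) ≤ scaleLattice (ϖ ^ (d₀ - 1)) w.1 ∧ ¬ w.1.map ((Matrix.toLin' (((γ : GL (Fin 3) K) : Matrix (Fin 3) (Fin 3) K) - 1)).restrictScalars 𝒪[K]) ≤ scaleLattice (ϖ ^ d₀) w.1))}).ncard = n₂ * (2 * Fintype.card 𝓀[K]) ∧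
    ∑ v ∈ sR, ({w | w ∈ {w | ∃ c, ((latticeGraph σ ϖ ((StdForm.antidiagonal 3).over K)).Adj v c ∧ (latticeGraph σ ϖ ((StdForm.antidiagonal 3).over K)).dist ⟨stdLattice K 3, 0, isSelfDualLattice_stdLattice_three_of_v hϖ⟩ c = (latticeGraph σ ϖ ((StdForm.antidiagonal 3).over K)).dist ⟨stdLattice K 3, 0, isSelfDualLattice_stdLattice_three_of_v hϖ⟩ v + 1 ∧ latticeGraphIso σ ϖ ((StdForm.antidiagonal 3).over K) γ c = c) ∧ ((latticeGraph σ ϖ ((StdForm.antidiagonal 3).over K)).Adj c w ∧ (latticeGraph σ ϖ ((StdForm.antidiagonal 3).over K)).dist ⟨stdLattice K 3, 0, isSelfDualLattice_stdLattice_three_of_v hϖ⟩ w = (latticeGraph σ ϖ ((StdForm.antidiagonal 3).over K)).dist ⟨stdLattice K 3, 0, isSelfDualLattice_stdLattice_three_of_v hϖ⟩ c + 1 ∧ latticeGraphIso σ ϖ ((StdForm.antidiagonal 3).over K) γ w = w)} ∧ (¬ w.1.map ((Matrix.toLin' (((γ : GL (Fin 3) K) : Matrix (Fin 3) (Fin 3)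 K) - 1)).restrictScalars 𝒪[K]) ≤ scaleLattice (ϖ ^ d₀) w.1 ∧ (w.1.map ((Matrix.toLin' (((γ : GL (Fin 3) K) : Matrix (Fin 3) (Fin 3) K) - 1)).restrictScalars 𝒪[K]) ≤ scaleLattice (ϖ ^ (d₀ - 2)) w.1 ∧ ¬ w.1.map ((Matrix.toLin' (((γ : GL (Fin 3) K) : Matrix (Fin 3) (Fin 3) K) - 1)).restrictScalars 𝒪[K]) ≤ scaleLattice (ϖ ^ (d₀ - 1)) w.1) ∧ ∃ y ∈ w.1, ∃ a : K, Valued.v a = 1 ∧ Valued.v ((ϖ ^ (d₀ - 2))⁻¹ * pairing σ ((StdForm.antidiagonal 3).over K) y ((((γ : GL (Fin 3) K) : Matrix (Fin 3) (Fin 3) K) - 1) *ᵥ y) - (c₁) * a ^ 2) < 1)}).ncard = n₀ * (Fintype.card 𝓀[K] * (Fintype.card 𝓀[K] - 1)) + n₁ * (Fintype.card 𝓀[K] * ((Fintype.card 𝓀[K] - 1) / 2)) + n₂ * (Fintype.card 𝓀[K] * ((Fintype.card 𝓀[K] - 3) / 2)) ∧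
    ∑ v ∈ sR, ({w | w ∈ {w | ∃ c, ((latticeGraph σ ϖ ((StdForm.antidiagonal 3).over K)).Adj v c ∧ (latticeGraph σ ϖ ((StdForm.antidiagonal 3).over K)).dist ⟨stdLattice K 3, 0, isSelfDualLattice_stdLattice_three_of_v hϖ⟩ c = (latticeGraph σ ϖ ((StdForm.antidiagonal 3).over K)).dist ⟨stdLattice K 3, 0, isSelfDualLattice_stdLattice_three_of_v hϖ⟩ v + 1 ∧ latticeGraphIso σ ϖ ((StdForm.antidiagonal 3).over K) γ c = c) ∧ ((latticeGraph σ ϖ ((StdForm.antidiagonal 3).over K)).Adj c w ∧ (latticeGraph σ ϖ ((StdForm.antidiagonal 3).over K)).dist ⟨stdLattice K 3, 0, isSelfDualLattice_stdLattice_three_of_v hϖ⟩ w = (latticeGraph σ ϖ ((StdForm.antidiagonal 3).over K)).dist ⟨stdLattice K 3, 0, isSelfDualLattice_stdLattice_three_of_v hϖ⟩ c + 1 ∧ latticeGraphIso σ ϖ ((StdForm.antidiagonal 3).over K) γ w = w)} ∧ (¬ w.1.map ((Matrix.toLin' (((γ : GL (Fin 3) K) : Matrix (Fin 3) (Fin 3)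 K) - 1)).restrictScalars 𝒪[K]) ≤ scaleLattice (ϖ ^ d₀) w.1 ∧ (w.1.map ((Matrix.toLin' (((γ : GL (Fin 3) K) : Matrix (Fin 3) (Fin 3) K) - 1)).restrictScalars 𝒪[K]) ≤ scaleLattice (ϖ ^ (d₀ - 2)) w.1 ∧ ¬ w.1.map ((Matrix.toLin' (((γ : GL (Fin 3) K) : Matrix (Fin 3) (Fin 3) K) - 1)).restrictScalars 𝒪[K]) ≤ scaleLattice (ϖ ^ (d₀ - 1)) w.1) ∧ ¬ (∃ y ∈ w.1, ∃ a : K, Valued.v a = 1 ∧ Valued.v ((ϖ ^ (d₀ - 2))⁻¹ * pairing σ ((StdForm.antidiagonal 3).over K) y ((((γ : GL (Fin 3) K) : Matrix (Fin 3) (Fin 3) K) - 1) *ᵥ y) - (c₁) * a ^ 2) < 1))}).ncard = n₁ * (Fintype.card 𝓀[K] * ((Fintype.card 𝓀[K] + 1) / 2)) + n₂ * (Fintype.card 𝓀[K] * ((Fintype.card 𝓀[K] - 1) / 2)) := by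
  have hn₀' := card_filter_eq_of_ncard_eq sR hsR (fun v => ∀ y ∈ v.1, y 1 = 0 → (((γ : GL (Fin 3) K) : Matrix (Fin 3) (Fin 3) K) - ((B₀ : Matrix (Fin 2) (Fin 2) K).trace / 2) • (1 : Matrix (Fin 3) (Fin 3) K)) *ᵥ y ∈ scaleLattice (ϖ ^ (d₀ + 1)) v.1) hn₀
  have hn₁' := card_filter_eq_of_ncard_eq sR hsR (fun v => ¬ (∀ y ∈ v.1, y 1 = 0 → (((γ : GL (Fin 3) K) : Matrix (Fin 3) (Fin 3) K) - ((B₀ : Matrix (Fin 2) (Fin 2) K).trace / 2) • (1 : Matrix (Fin 3) (Fin 3) K)) *ᵥ y ∈ scaleLattice (ϖ ^ (d₀ + 1)) v.1) ∧ ¬ (∃ y ∈ v.1, y 1 = 0 ∧ ∃ a : K, Valued.v a = 1 ∧ Valued.v ((ϖ ^ d₀)⁻¹ * pairing σ ((StdForm.antidiagonal 3).over K) y ((((γ : GL (Fin 3) K) : Matrix (Fin 3) (Fin 3) K) - ((B₀ : Matrix (Fin 2) (Fin 2) K).trace / 2) • (1 : Matrix (Fin 3) (Fin 3) K)) *ᵥ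 y) - ((ϖ ^ d₀)⁻¹ * ((B₀ : Matrix (Fin 2) (Fin 2) K).trace / 2 - 1)) * a ^ 2) < 1)) hn₁
  have hn₂' := card_filter_eq_of_ncard_eq sR hsR (fun v => ¬ (∀ y ∈ v.1, y 1 = 0 → (((γ : GL (Fin 3) K) : Matrix (Fin 3) (Fin 3) K) - ((B₀ : Matrix (Fin 2) (Fin 2) K).trace / 2) • (1 : Matrix (Fin 3) (Fin 3) K)) *ᵥ y ∈ scaleLattice (ϖ ^ (d₀ + 1)) v.1) ∧ (∃ y ∈ v.1, y 1 = 0 ∧ ∃ a : K, Valued.v a = 1 ∧ Valued.v ((ϖ ^ d₀)⁻¹ * pairing σ ((StdForm.antidiagonal 3).over K) y ((((γ : GL (Fin 3) K) : Matrix (Fin 3) (Fin 3) K) - ((B₀ : Matrix (Fin 2) (Fin 2) K).trace / 2) • (1 : Matrix (Fin 3) (Fin 3) K)) *ᵥ y) - ((ϖ ^ d₀)⁻¹ * ((B₀ : Matrix (Fin 2) (Fin 2) K).trace / 2 - 1)) * a ^ 2) < 1)) hn₂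
  have hI := hyperbolicVertexCensus_inner_of_lock hσ hvσ hσϖ hϖ hres h2 hnorm hT B₀ hγ hd3 hodd hnil3 hBm hdisc hcB c₁ ε hc₁ hεv hε hΛ
  have hS := hyperbolicVertexCensus_small_of_lock hσ hvσ hσϖ hϖ hres h2 hnorm hT B₀ hγ hd3 hodd hnil3 hBm hdisc hcB c₁ ε hc₁ hεv hε hΛ
  have hB := hyperbolicVertexCensus_big_of_lock hσ hvσ hσϖ hϖ hres h2 hnorm hT B₀ hγ hd3 hodd hnil3 hBm hdisc hcB c₁ ε hc₁ hεv hε hΛ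
  obtain ⟨hc, hE, hP, hM⟩ := Literature.NumberTheory.Rogawski1990.regionCensus_block_of_kindCounts hϖ c₁ sR (fun v => ∀ y ∈ v.1, y 1 = 0 → (((γ : GL (Fin 3) K) : Matrix (Fin 3) (Fin 3) K) - ((B₀ : Matrix (Fin 2) (Fin 2) K).trace / 2) • (1 : Matrix (Fin 3) (Fin 3) K)) *ᵥ y ∈ scaleLattice (ϖ ^ (d₀ + 1)) v.1) (fun v => ∃ y ∈ v.1, y 1 = 0 ∧ ∃ a : K, Valued.v a = 1 ∧ Valued.v ((ϖ ^ d₀)⁻¹ * pairing σ ((StdForm.antidiagonal 3).over K) y ((((γ : GL (Fin 3) K) : Matrix (Fin 3) (Fin 3) K) - ((B₀ : Matrix (Fin 2) (Fin 2) K).trace / 2) • (1 : Matrix (Fin 3) (Fin 3) K)) *ᵥ y) - ((ϖ ^ d₀)⁻¹ * ((B₀ : Matrix (Fin 2) (Fin 2) K).trace / 2 - 1)) * a ^ 2) < 1) n₀ n₁ n₂ hn₀' hn₁' hn₂'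
    0 0 (2 * Fintype.card 𝓀[K]) (Fintype.card 𝓀[K] * (Fintype.card 𝓀[K] - 1)) (Fintype.card 𝓀[K] * ((Fintype.card 𝓀[K] - 1) / 2)) (Fintype.card 𝓀[K] * ((Fintype.card 𝓀[K] - 3) / 2)) 0 (Fintype.card 𝓀[K] * ((Fintype.card 𝓀[K] + 1) / 2)) (Fintype.card 𝓀[K] * ((Fintype.card 𝓀[K] - 1) / 2))
    (fun v hv hP => (hI v ((hsR v).1 hv) hP).1) (fun v hv hP hQ => (hS v ((hsR v).1 hv) hP hQ).1) (fun v hv hP hQ => (hB v ((hsR v).1 hv) hP hQ).1)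
    (fun v hv hP => (hI v ((hsR v).1 hv) hP).2.1) (fun v hv hP hQ => (hS v ((hsR v).1 hv) hP hQ).2.1) (fun v hv hP hQ => (hB v ((hsR v).1 hv) hP hQ).2.1)
    (fun v hv hP => (hI v ((hsR v).1 hv) hP).2.2) (fun v hv hP hQ => (hS v ((hsR v).1 hv) hP hQ).2.2) (fun v hv hP hQ => (hB v ((hsR v).1 hv) hP hQ).2.2)
  refine ⟨hc, ?_, ?_, ?_⟩
  · exact hE.trans (by ring)
  · exact hP.trans (by ring)
  · exact hM.trans (by ring)

set_option maxHeartbeats 3200000 in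
-- budget only: statement-heavy lattice tokens (three grandchild sets, region and kind sets).
/-- **(K4c) REGION SUMS, NO LOCK `¬Λ(c₁)`**: `#sR = n₀ + n₁ + n₂`, `ΣE = n₂·2q`, `ΣP = n₁·q((q+1)/2) + n₂·q((q−1)/2)`, `ΣM = n₀·q(q−1) + n₁·q((q−1)/2) + n₂·q((q−3)/2)` (★ (4a) ∘ ★ (K4b)).
[cite: Kottwitz1986, §3] [cite: Rogawski1990, §4.9 Prop. 4.9.1 (b) p. 55] [cite: LabesseLanglands1979, §2 Lemma 2.1] -/
theorem regionSums_hyperbolic_of_kindCounts_of_not_lock (hσ : ∀ x, σ (σ x) = x) (hvσ : ∀ a, Valued.v (σ a) = Valued.v a) (hσϖ : σ ϖ = -ϖ)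
    (hϖ : Valued.v ϖ = WithZero.exp (-1 : ℤ)) (hres : ∀ x : K, Valued.v x ≤ 1 → Valued.v (σ x - x) < 1) (h2 : Valued.v (2 : K) = 1)
    (hnorm : ∀ u : K, σ u = u → Valued.v (u - 1) < 1 → ∃ z : K, z * σ z = u ∧ Valued.v (z - 1) ≤ Valued.v (u - 1))
    [Fintype 𝓀[K]] [DecidableEq 𝓀[K]] [ValuativeRel K] [(Valued.v : Valuation K ℤᵐ⁰).Compatible] [IsPrincipalIdealRing 𝒪[K]]
    (hT : (latticeGraph σ ϖ ((StdForm.antidiagonal 3).over K)).IsTree)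
    {γ : unitaryGroupOfForm σ ((StdForm.antidiagonal 3).over K)} (B₀ : GL (Fin 2) K) (hγ : (γ : GL (Fin 3) K) = endoGL (B₀, (1 : GL (Fin 1) K)))
    {d₀ : ℕ} (hd3 : 3 ≤ d₀) (hodd : Odd d₀)
    (hnil3 : ∀ (w : {M : Submodule 𝒪[K] (Fin 3 → K) // IsVertex σ ϖ ((StdForm.antidiagonal 3).over K) M}) (e : ℕ), e + 1 ≤ d₀ →
      w.1.map ((Matrix.toLin' (((γ : GL (Fin 3) K) : Matrix (Fin 3) (Fin 3) K) - 1)).restrictScalars 𝒪[K]) ≤ scaleLattice (ϖ ^ e) w.1 →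
      w.1.map ((Matrix.toLin' ((((γ : GL (Fin 3) K) : Matrix (Fin 3) (Fin 3) K) - 1) ^ 3)).restrictScalars 𝒪[K]) ≤ scaleLattice (ϖ ^ (3 * e + 1)) w.1)
    (hBm : ∀ i j, Valued.v (((B₀ : Matrix (Fin 2) (Fin 2) K) - 1) i j) ≤ Valued.v ϖ ^ d₀)
    (hdisc : Valued.v ((B₀ : Matrix (Fin 2) (Fin 2) K).trace ^ 2 - 4 * (B₀ : Matrix (Fin 2) (Fin 2) K).det) < Valued.v ϖ ^ (2 * d₀))
    (hcB : Valued.v ((B₀ : Matrix (Fin 2) (Fin 2) K).trace / 2 - 1) = Valued.v ϖ ^ d₀)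
    (c₁ ε : K) (hc₁ : Valued.v c₁ = 1) (hεv : Valued.v ε = 1) (hε : ∀ z : K, Valued.v z ≤ 1 → Valued.v (z ^ 2 - ε) = 1)
    (sR : Finset {M : Submodule 𝒪[K] (Fin 3 → K) // IsVertex σ ϖ ((StdForm.antidiagonal 3).over K) M})
    (hsR : ∀ v, v ∈ sR ↔ v ∈ {v : {M : Submodule 𝒪[K] (Fin 3 → K) // IsVertex σ ϖ ((StdForm.antidiagonal 3).over K) M} | latticeGraphIso σ ϖ ((StdForm.antidiagonal 3).over K) γ v = v ∧ IsSelfDualLattice σ ϖ ((StdForm.antidiagonal 3).over K) v.1 ∧ v.1.map ((Matrix.toLin' (((γ : GL (Fin 3) K) : Matrix (Fin 3) (Fin 3) K) - 1)).restrictScalars 𝒪[K]) ≤ scaleLattice (ϖ ^ d₀) v.1})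
    (n₀ n₁ n₂ : ℕ) (hn₀ : {v : {M : Submodule 𝒪[K] (Fin 3 → K) // IsVertex σ ϖ ((StdForm.antidiagonal 3).over K) M} | v ∈ {v : {M : Submodule 𝒪[K] (Fin 3 → K) // IsVertex σ ϖ ((StdForm.antidiagonal 3).over K) M} | latticeGraphIso σ ϖ ((StdForm.antidiagonal 3).over K) γ v = v ∧ IsSelfDualLattice σ ϖ ((StdForm.antidiagonal 3).over K) v.1 ∧ v.1.map ((Matrix.toLin' (((γ : GL (Fin 3) K) : Matrix (Fin 3) (Fin 3) K) - 1)).restrictScalars 𝒪[K]) ≤ scaleLattice (ϖ ^ d₀) v.1} ∧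
        ∀ y ∈ v.1, y 1 = 0 → ((((γ : GL (Fin 3) K) : Matrix (Fin 3) (Fin 3) K) - ((B₀ : Matrix (Fin 2) (Fin 2) K).trace / 2) • (1 : Matrix (Fin 3) (Fin 3) K)) *ᵥ y) ∈ scaleLattice (ϖ ^ (d₀ + 1)) v.1}.ncard = n₀)
    (hn₁ : {v : {M : Submodule 𝒪[K] (Fin 3 → K) // IsVertex σ ϖ ((StdForm.antidiagonal 3).over K) M} | v ∈ {v : {M : Submodule 𝒪[K] (Fin 3 → K) // IsVertex σ ϖ ((StdForm.antidiagonal 3).over K) M} | latticeGraphIso σ ϖ ((StdForm.antidiagonal 3).over K) γ v = v ∧ IsSelfDualLattice σ ϖ ((StdForm.antidiagonal 3).over K) v.1 ∧ v.1.map ((Matrix.toLin' (((γ : GL (Fin 3) K) : Matrix (Fin 3) (Fin 3) K) - 1)).restrictScalars 𝒪[K]) ≤ scaleLattice (ϖ ^ d₀) v.1} ∧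
        ¬ (∀ y ∈ v.1, y 1 = 0 → ((((γ : GL (Fin 3) K) : Matrix (Fin 3) (Fin 3) K) - ((B₀ : Matrix (Fin 2) (Fin 2) K).trace / 2) • (1 : Matrix (Fin 3) (Fin 3) K)) *ᵥ y) ∈ scaleLattice (ϖ ^ (d₀ + 1)) v.1) ∧
        ¬ (∃ y ∈ v.1, y 1 = 0 ∧ ∃ a : K, Valued.v a = 1 ∧ Valued.v ((ϖ ^ d₀)⁻¹ * pairing σ ((StdForm.antidiagonal 3).over K) y ((((γ : GL (Fin 3) K) : Matrix (Fin 3) (Fin 3) K) - ((B₀ : Matrix (Fin 2) (Fin 2) K).trace / 2) • (1 : Matrix (Fin 3) (Fin 3) K)) *ᵥ y) - ((ϖ ^ d₀)⁻¹ * ((B₀ : Matrix (Fin 2) (Fin 2) K).trace / 2 - 1)) * a ^ 2) < 1)}.ncard = n₁)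
    (hn₂ : {v : {M : Submodule 𝒪[K] (Fin 3 → K) // IsVertex σ ϖ ((StdForm.antidiagonal 3).over K) M} | v ∈ {v : {M : Submodule 𝒪[K] (Fin 3 → K) // IsVertex σ ϖ ((StdForm.antidiagonal 3).over K) M} | latticeGraphIso σ ϖ ((StdForm.antidiagonal 3).over K) γ v = v ∧ IsSelfDualLattice σ ϖ ((StdForm.antidiagonal 3).over K) v.1 ∧ v.1.map ((Matrix.toLin' (((γ : GL (Fin 3) K) : Matrix (Fin 3) (Fin 3) K) - 1)).restrictScalars 𝒪[K]) ≤ scaleLattice (ϖ ^ d₀) v.1} ∧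
        ¬ (∀ y ∈ v.1, y 1 = 0 → ((((γ : GL (Fin 3) K) : Matrix (Fin 3) (Fin 3) K) - ((B₀ : Matrix (Fin 2) (Fin 2) K).trace / 2) • (1 : Matrix (Fin 3) (Fin 3) K)) *ᵥ y) ∈ scaleLattice (ϖ ^ (d₀ + 1)) v.1) ∧
        ∃ y ∈ v.1, y 1 = 0 ∧ ∃ a : K, Valued.v a = 1 ∧ Valued.v ((ϖ ^ d₀)⁻¹ * pairing σ ((StdForm.antidiagonal 3).over K) y ((((γ : GL (Fin 3) K) : Matrix (Fin 3) (Fin 3) K) - ((B₀ : Matrix (Fin 2) (Fin 2) K).trace / 2) • (1 : Matrix (Fin 3) (Fin 3) K)) *ᵥ y) - ((ϖ ^ d₀)⁻¹ * ((B₀ : Matrix (Fin 2) (Fin 2) K).trace / 2 - 1)) * a ^ 2) < 1}.ncard = n₂)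
    (hΛ : ¬ (∃ a : K, Valued.v a = 1 ∧ Valued.v (((ϖ ^ d₀)⁻¹ * ((B₀ : Matrix (Fin 2) (Fin 2) K).trace / 2 - 1)) - c₁ * a ^ 2) < 1)) :
    sR.card = n₀ + n₁ + n₂ ∧
    ∑ v ∈ sR, ({w | w ∈ {w | ∃ c, ((latticeGraph σ ϖ ((StdForm.antidiagonal 3).over K)).Adj v c ∧ (latticeGraph σ ϖ ((StdForm.antidiagonal 3).over K)).dist ⟨stdLattice K 3, 0, isSelfDualLattice_stdLattice_three_of_v hϖ⟩ c = (latticeGraph σ ϖ ((StdForm.antidiagonal 3).over K)).dist ⟨stdLattice K 3, 0, isSelfDualLattice_stdLattice_three_of_v hϖ⟩ v + 1 ∧ latticeGraphIso σ ϖ ((StdForm.antidiagonal 3).over K) γ c = c) ∧ ((latticeGraph σ ϖ ((StdForm.antidiagonal 3).over K)).Adj c w ∧ (latticeGraph σ ϖ ((StdForm.antidiagonal 3).over K)).dist ⟨stdLattice K 3, 0, isSelfDualLattice_stdLattice_three_of_v hϖ⟩ w = (latticeGraph σ ϖ ((StdForm.antidiagonal 3).over K)).dist ⟨stdLattice K 3,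 0, isSelfDualLattice_stdLattice_three_of_v hϖ⟩ c + 1 ∧ latticeGraphIso σ ϖ ((StdForm.antidiagonal 3).over K) γ w = w)} ∧ (¬ w.1.map ((Matrix.toLin' (((γ : GL (Fin 3) K) : Matrix (Fin 3) (Fin 3) K) - 1)).restrictScalars 𝒪[K]) ≤ scaleLattice (ϖ ^ d₀) w.1 ∧ (w.1.map ((Matrix.toLin' (((γ : GL (Fin 3) K) : Matrix (Fin 3) (Fin 3) K) - 1)).restrictScalars 𝒪[K]) ≤ scaleLattice (ϖ ^ (d₀ - 1)) w.1 ∧ ¬ w.1.map ((Matrix.toLin' (((γ : GL (Fin 3) K) : Matrix (Fin 3) (Fin 3) K) - 1)).restrictScalars 𝒪[K]) ≤ scaleLattice (ϖ ^ d₀) w.1))}).ncard = n₂ * (2 * Fintype.card 𝓀[K]) ∧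
    ∑ v ∈ sR, ({w | w ∈ {w | ∃ c, ((latticeGraph σ ϖ ((StdForm.antidiagonal 3).over K)).Adj v c ∧ (latticeGraph σ ϖ ((StdForm.antidiagonal 3).over K)).dist ⟨stdLattice K 3, 0, isSelfDualLattice_stdLattice_three_of_v hϖ⟩ c = (latticeGraph σ ϖ ((StdForm.antidiagonal 3).over K)).dist ⟨stdLattice K 3, 0, isSelfDualLattice_stdLattice_three_of_v hϖ⟩ v + 1 ∧ latticeGraphIso σ ϖ ((StdForm.antidiagonal 3).over K) γ c = c) ∧ ((latticeGraph σ ϖ ((StdForm.antidiagonal 3).over K)).Adj c w ∧ (latticeGraph σ ϖ ((StdForm.antidiagonal 3).over K)).dist ⟨stdLattice K 3, 0, isSelfDualLattice_stdLattice_three_of_v hϖ⟩ w = (latticeGraph σ ϖ ((StdForm.antidiagonal 3).over K)).dist ⟨stdLattice K 3, 0, isSelfDualLattice_stdLattice_three_of_v hϖ⟩ c + 1 ∧ latticeGraphIso σ ϖ ((StdForm.antidiagonal 3).over K) γ w = w)} ∧ (¬ w.1.map ((Matrix.toLin' (((γ : GL (Fin 3) K) : Matrix (Fin 3) (Fin 3)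 K) - 1)).restrictScalars 𝒪[K]) ≤ scaleLattice (ϖ ^ d₀) w.1 ∧ (w.1.map ((Matrix.toLin' (((γ : GL (Fin 3) K) : Matrix (Fin 3) (Fin 3) K) - 1)).restrictScalars 𝒪[K]) ≤ scaleLattice (ϖ ^ (d₀ - 2)) w.1 ∧ ¬ w.1.map ((Matrix.toLin' (((γ : GL (Fin 3) K) : Matrix (Fin 3) (Fin 3) K) - 1)).restrictScalars 𝒪[K]) ≤ scaleLattice (ϖ ^ (d₀ - 1)) w.1) ∧ ∃ y ∈ w.1, ∃ a : K, Valued.v a = 1 ∧ Valued.v ((ϖ ^ (d₀ - 2))⁻¹ * pairing σ ((StdForm.antidiagonal 3).over K) y ((((γ : GL (Fin 3) K) : Matrix (Fin 3) (Fin 3) K) - 1) *ᵥ y) - (c₁) * a ^ 2) < 1)}).ncard = n₁ * (Fintype.card 𝓀[K] * ((Fintype.card 𝓀[K] + 1) / 2)) + n₂ * (Fintype.card 𝓀[K] * ((Fintype.card 𝓀[K] - 1) / 2)) ∧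
    ∑ v ∈ sR, ({w | w ∈ {w | ∃ c, ((latticeGraph σ ϖ ((StdForm.antidiagonal 3).over K)).Adj v c ∧ (latticeGraph σ ϖ ((StdForm.antidiagonal 3).over K)).dist ⟨stdLattice K 3, 0, isSelfDualLattice_stdLattice_three_of_v hϖ⟩ c = (latticeGraph σ ϖ ((StdForm.antidiagonal 3).over K)).dist ⟨stdLattice K 3, 0, isSelfDualLattice_stdLattice_three_of_v hϖ⟩ v + 1 ∧ latticeGraphIso σ ϖ ((StdForm.antidiagonal 3).over K) γ c = c) ∧ ((latticeGraph σ ϖ ((StdForm.antidiagonal 3).over K)).Adj c w ∧ (latticeGraph σ ϖ ((StdForm.antidiagonal 3).over K)).dist ⟨stdLattice K 3, 0, isSelfDualLattice_stdLattice_three_of_v hϖ⟩ w = (latticeGraph σ ϖ ((StdForm.antidiagonal 3).over K)).dist ⟨stdLattice K 3, 0, isSelfDualLattice_stdLattice_three_of_v hϖ⟩ c + 1 ∧ latticeGraphIso σ ϖ ((StdForm.antidiagonal 3).over K) γ w = w)} ∧ (¬ w.1.map ((Matrix.toLin' (((γ : GL (Fin 3) K) : Matrix (Fin 3) (Fin 3)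 K) - 1)).restrictScalars 𝒪[K]) ≤ scaleLattice (ϖ ^ d₀) w.1 ∧ (w.1.map ((Matrix.toLin' (((γ : GL (Fin 3) K) : Matrix (Fin 3) (Fin 3) K) - 1)).restrictScalars 𝒪[K]) ≤ scaleLattice (ϖ ^ (d₀ - 2)) w.1 ∧ ¬ w.1.map ((Matrix.toLin' (((γ : GL (Fin 3) K) : Matrix (Fin 3) (Fin 3) K) - 1)).restrictScalars 𝒪[K]) ≤ scaleLattice (ϖ ^ (d₀ - 1)) w.1) ∧ ¬ (∃ y ∈ w.1, ∃ a : K, Valued.v a = 1 ∧ Valued.v ((ϖ ^ (d₀ - 2))⁻¹ * pairing σ ((StdForm.antidiagonal 3).over K) y ((((γ : GL (Fin 3) K) : Matrix (Fin 3) (Fin 3) K) - 1) *ᵥ y) - (c₁) * a ^ 2) < 1))}).ncard = n₀ * (Fintype.card 𝓀[K] * (Fintype.card 𝓀[K] - 1)) + n₁ * (Fintype.card 𝓀[K] * ((Fintype.card 𝓀[K] - 1) / 2)) + n₂ * (Fintype.card 𝓀[K] * ((Fintype.card 𝓀[K] - 3) / 2)) := by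
  have hn₀' := card_filter_eq_of_ncard_eq sR hsR (fun v => ∀ y ∈ v.1, y 1 = 0 → (((γ : GL (Fin 3) K) : Matrix (Fin 3) (Fin 3) K) - ((B₀ : Matrix (Fin 2) (Fin 2) K).trace / 2) • (1 : Matrix (Fin 3) (Fin 3) K)) *ᵥ y ∈ scaleLattice (ϖ ^ (d₀ + 1)) v.1) hn₀
  have hn₁' := card_filter_eq_of_ncard_eq sR hsR (fun v => ¬ (∀ y ∈ v.1, y 1 = 0 → (((γ : GL (Fin 3) K) : Matrix (Fin 3) (Fin 3) K) - ((B₀ : Matrix (Fin 2) (Fin 2) K).trace / 2) • (1 : Matrix (Fin 3) (Fin 3) K)) *ᵥ y ∈ scaleLattice (ϖ ^ (d₀ + 1)) v.1) ∧ ¬ (∃ y ∈ v.1, y 1 = 0 ∧ ∃ a : K, Valued.v a = 1 ∧ Valued.v ((ϖ ^ d₀)⁻¹ * pairing σ ((StdForm.antidiagonal 3).over K) y ((((γ : GL (Fin 3) K) : Matrix (Fin 3) (Fin 3) K) - ((B₀ : Matrix (Fin 2) (Fin 2) K).trace / 2) • (1 : Matrix (Fin 3) (Fin 3) K)) *ᵥ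 y) - ((ϖ ^ d₀)⁻¹ * ((B₀ : Matrix (Fin 2) (Fin 2) K).trace / 2 - 1)) * a ^ 2) < 1)) hn₁
  have hn₂' := card_filter_eq_of_ncard_eq sR hsR (fun v => ¬ (∀ y ∈ v.1, y 1 = 0 → (((γ : GL (Fin 3) K) : Matrix (Fin 3) (Fin 3) K) - ((B₀ : Matrix (Fin 2) (Fin 2) K).trace / 2) • (1 : Matrix (Fin 3) (Fin 3) K)) *ᵥ y ∈ scaleLattice (ϖ ^ (d₀ + 1)) v.1) ∧ (∃ y ∈ v.1, y 1 = 0 ∧ ∃ a : K, Valued.v a = 1 ∧ Valued.v ((ϖ ^ d₀)⁻¹ * pairing σ ((StdForm.antidiagonal 3).over K) y ((((γ : GL (Fin 3) K) : Matrix (Fin 3) (Fin 3) K) - ((B₀ : Matrix (Fin 2) (Fin 2) K).trace / 2) • (1 : Matrix (Fin 3) (Fin 3) K)) *ᵥ y) - ((ϖ ^ d₀)⁻¹ * ((B₀ : Matrix (Fin 2) (Fin 2) K).trace / 2 - 1)) * a ^ 2) < 1)) hn₂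
  have hI := hyperbolicVertexCensus_inner_of_not_lock hσ hvσ hσϖ hϖ hres h2 hnorm hT B₀ hγ hd3 hodd hnil3 hBm hdisc hcB c₁ ε hc₁ hεv hε hΛ
  have hS := hyperbolicVertexCensus_small_of_not_lock hσ hvσ hσϖ hϖ hres h2 hnorm hT B₀ hγ hd3 hodd hnil3 hBm hdisc hcB c₁ ε hc₁ hεv hε hΛ
  have hB := hyperbolicVertexCensus_big_of_not_lock hσ hvσ hσϖ hϖ hres h2 hnorm hT B₀ hγ hd3 hodd hnil3 hBm hdisc hcB c₁ ε hc₁ hεv hε hΛ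
  obtain ⟨hc, hE, hP, hM⟩ := Literature.NumberTheory.Rogawski1990.regionCensus_block_of_kindCounts hϖ c₁ sR (fun v => ∀ y ∈ v.1, y 1 = 0 → (((γ : GL (Fin 3) K) : Matrix (Fin 3) (Fin 3) K) - ((B₀ : Matrix (Fin 2) (Fin 2) K).trace / 2) • (1 : Matrix (Fin 3) (Fin 3) K)) *ᵥ y ∈ scaleLattice (ϖ ^ (d₀ + 1)) v.1) (fun v => ∃ y ∈ v.1, y 1 = 0 ∧ ∃ a : K, Valued.v a = 1 ∧ Valued.v ((ϖ ^ d₀)⁻¹ * pairing σ ((StdForm.antidiagonal 3).over K) y ((((γ : GL (Fin 3) K) : Matrix (Fin 3) (Fin 3) K) - ((B₀ : Matrix (Fin 2) (Fin 2) K).trace / 2) • (1 : Matrix (Fin 3) (Fin 3) K)) *ᵥ y) - ((ϖ ^ d₀)⁻¹ * ((B₀ : Matrix (Fin 2) (Fin 2) K).trace / 2 - 1)) * a ^ 2) < 1) n₀ n₁ n₂ hn₀' hn₁' hn₂'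
    0 0 (2 * Fintype.card 𝓀[K]) 0 (Fintype.card 𝓀[K] * ((Fintype.card 𝓀[K] + 1) / 2)) (Fintype.card 𝓀[K] * ((Fintype.card 𝓀[K] - 1) / 2)) (Fintype.card 𝓀[K] * (Fintype.card 𝓀[K] - 1)) (Fintype.card 𝓀[K] * ((Fintype.card 𝓀[K] - 1) / 2)) (Fintype.card 𝓀[K] * ((Fintype.card 𝓀[K] - 3) / 2))
    (fun v hv hP => (hI v ((hsR v).1 hv) hP).1) (fun v hv hP hQ => (hS v ((hsR v).1 hv) hP hQ).1) (fun v hv hP hQ => (hB v ((hsR v).1 hv) hP hQ).1)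
    (fun v hv hP => (hI v ((hsR v).1 hv) hP).2.1) (fun v hv hP hQ => (hS v ((hsR v).1 hv) hP hQ).2.1) (fun v hv hP hQ => (hB v ((hsR v).1 hv) hP hQ).2.1)
    (fun v hv hP => (hI v ((hsR v).1 hv) hP).2.2) (fun v hv hP hQ => (hS v ((hsR v).1 hv) hP hQ).2.2) (fun v hv hP hQ => (hB v ((hsR v).1 hv) hP hQ).2.2)
  refine ⟨hc, ?_, ?_, ?_⟩
  · exact hE.trans (by ring)
  · exact hP.trans (by ring)
  · exact hM.trans (by ring)

end Literature.NumberTheory.Rogawski1990.TypeOneRamifiedJunction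

end
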